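import Literature.Analysis.ODE.SoninEnvelope
import HarnessLib

/-!
# Growth along a classically forbidden half-line: a bounded-at-`−∞` complex solution of
# `u″ = q u`, `q ≥ 0` on `(−∞, b]`, is outward-growing there

Topic `Literature/Analysis/ODE` (namespace `Literature.Analysis.ODE`), complement of the interval
statements of `SoninEnvelope.lean` (`convexOn_norm_sq_of_nonneg`, `monotoneOn_norm_sq_of_nonneg`:
on `[α, β]` with `q ≥ 0` the function `|u|²` is convex, and non-decreasing as soon as
`Re(ū u′)(α) ≥ 0`). On a HALF-LINE `(−∞, b]` the boundary condition at the left end is replaced by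
mere boundedness:

* `re_conj_mul_deriv_nonneg_of_isBoundedUnder` — if `u″ = q u` with `q ≥ 0` on `(−∞, b]` and `|u|`
  is bounded as `x → −∞`, then `Re(ū(x) u′(x)) ≥ 0` for every `x ≤ b` (the derivative
  `2Re(ū u′)` of the convex function `|u|²` is non-decreasing; were it negative at `x₀`, `|u|²` would
  grow at least linearly as `x → −∞`);
* `norm_le_norm_of_isBoundedUnder` — hence `|u(x)| ≤ |u(y)|` for `x ≤ y ≤ b`
  (`monotoneOn_norm_of_isBoundedUnder`).

This is the form in which the horizon-normalised solution of Carter's radial equation AT THE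
SUPERRADIANT THRESHOLD (`|u_𝓗| → 1` at `r* → −∞`, barrier `(−∞, b₂]` touching the horizon in
Breitenlohner–Freedman stable sectors) is seen to grow monotonically across the WHOLE barrier, in the
tortoise variable and without any information on where the `r`-form of the barrier ends (compare
`Literature/Geometry/Lorentzian/CarterThresholdMonotone.lean`, which argues in `r` up to the `r`-form
turning point). Hypotheses are pointwise `HasDerivAt` statements; everything is proved.

## References
* P. Hartman, *Ordinary Differential Equations* (SIAM Classics 38, 2002), Ch. XI §6 (disconjugacy on a
  half-line; principal solutions; convexity of positive solutions when `q ≥ 0`, Cor. 6.4).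
  Key `Hartman2002`.
-/

noncomputable section

open Set Filter
open scoped ComplexConjugate _root_.Topology

namespace Literature.Analysis.ODE

/-- **Outward growth along a forbidden half-line.** Let `u″ = q u` (complex `u`, real `q ≥ 0`) on
`(−∞, b]`, with pointwise `HasDerivAt` data, and let `|u|` be bounded above as `x → −∞`. Then
`Re(ū(x)·u′(x)) ≥ 0` for every `x ≤ b`. [cite: Hartman2002, Ch. XI Cor. 6.4 (proof)] -/
theorem re_conj_mul_deriv_nonneg_of_isBoundedUnder {u u' : ℝ → ℂ} {q : ℝ → ℝ} {b : ℝ}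
    (h : ∀ x ∈ Iic b, HasDerivAt u (u' x) x ∧ HasDerivAt u' ((q x : ℂ) * u x) x)
    (hq : ∀ x ∈ Iic b, 0 ≤ q x) (hbdd : IsBoundedUnder (· ≤ ·) atBot fun x ↦ ‖u x‖) :
    ∀ x ∈ Iic b, 0 ≤ (conj (u x) * u' x).re := by
  have h1 : ∀ x ∈ Iic b, HasDerivAt (fun y ↦ ‖u y‖ ^ 2) (2 * (conj (u x) * u' x).re) x :=
    fun x hx ↦ hasDerivAt_norm_sq_complex (h x hx).1
  have h2 : ∀ x ∈ Iic b, HasDerivAt (fun y ↦ 2 * (conj (u y) * u' y).re)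
      (2 * ‖u' x‖ ^ 2 + 2 * q x * ‖u x‖ ^ 2) x :=
    fun x hx ↦ hasDerivAt_two_re_conj_mul (h x hx).1 (h x hx).2
  -- `g = 2 Re(ū u′)` is non-decreasing on `(−∞, b]`
  have hg : MonotoneOn (fun y ↦ 2 * (conj (u y) * u' y).re) (Iic b) := by
    refine monotoneOn_of_deriv_nonneg (convex_Iic b)
      (fun x hx ↦ (h2 x hx).continuousAt.continuousWithinAt)
      (fun x hx ↦ (h2 x (interior_subset hx)).differentiableAt.differentiableWithinAt) ?_
    intro x hx
    rw [(h2 x (interior_subset hx)).deriv]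
    have := hq x (interior_subset hx)
    positivity
  intro x₀ hx₀
  by_contra hneg
  push Not at hneg
  set c := -(2 * (conj (u x₀) * u' x₀).re) with hc
  have hc0 : 0 < c := by rw [hc]; linarith
  -- `f(y) = |u y|² + c y` is non-increasing on `(−∞, x₀]`
  have hf : AntitoneOn (fun y ↦ ‖u y‖ ^ 2 + c * y) (Iic x₀) := by
    have hf' : ∀ y ∈ Iic x₀, HasDerivAt (fun y ↦ ‖u y‖ ^ 2 + c * y)
        (2 * (conj (u y) * u' y).re + c) y := fun y hy ↦
      (h1 y (mem_Iic.2 ((mem_Iic.1 hy).trans hx₀))).add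
        ((hasDerivAt_id' y).const_mul c |>.congr_deriv (by ring))
    refine antitoneOn_of_deriv_nonpos (convex_Iic x₀)
      (fun y hy ↦ (hf' y hy).continuousAt.continuousWithinAt)
      (fun y hy ↦ (hf' y (interior_subset hy)).differentiableAt.differentiableWithinAt) ?_
    intro y hy
    have hy' : y ∈ Iic x₀ := interior_subset hy
    rw [(hf' y hy').deriv]
    have hmono := hg (mem_Iic.2 ((mem_Iic.1 hy').trans hx₀)) hx₀ (mem_Iic.1 hy')
    simp only at hmono
    linarith
  -- hence `|u y|² ≥ |u x₀|² + c (x₀ − y)` for `y ≤ x₀`, contradicting boundedness at `−∞`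
  have hgrow : ∀ y, y ≤ x₀ → ‖u x₀‖ ^ 2 + c * (x₀ - y) ≤ ‖u y‖ ^ 2 := by
    intro y hy
    have := hf (mem_Iic.2 hy) (mem_Iic.2 le_rfl) hy
    simp only at this
    linarith
  obtain ⟨B, hB⟩ := hbdd
  rw [eventually_map] at hB
  obtain ⟨y, hyB, hyx⟩ := (hB.and (eventually_le_atBot (min x₀ (x₀ - (B ^ 2 + 1) / c)))).exists
  have hy₀ : y ≤ x₀ := hyx.trans (min_le_left _ _)
  have hy₁ : y ≤ x₀ - (B ^ 2 + 1) / c := hyx.trans (min_le_right _ _)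
  have hB0 : 0 ≤ B := (norm_nonneg _).trans hyB
  have hsq : ‖u y‖ ^ 2 ≤ B ^ 2 := pow_le_pow_left₀ (norm_nonneg _) hyB 2
  have hcy : B ^ 2 + 1 ≤ c * (x₀ - y) := by
    have : (B ^ 2 + 1) / c ≤ x₀ - y := by linarith
    rwa [div_le_iff₀' hc0] at this
  have := hgrow y hy₀
  nlinarith [sq_nonneg ‖u x₀‖]

/-- **Monotone growth along a forbidden half-line**: under the hypotheses of
`re_conj_mul_deriv_nonneg_of_isBoundedUnder`, `x ↦ |u(x)|` is non-decreasing on `(−∞, b]`.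
[cite: Hartman2002, Ch. XI Cor. 6.4 (proof)] -/
theorem monotoneOn_norm_of_isBoundedUnder {u u' : ℝ → ℂ} {q : ℝ → ℝ} {b : ℝ}
    (h : ∀ x ∈ Iic b, HasDerivAt u (u' x) x ∧ HasDerivAt u' ((q x : ℂ) * u x) x)
    (hq : ∀ x ∈ Iic b, 0 ≤ q x) (hbdd : IsBoundedUnder (· ≤ ·) atBot fun x ↦ ‖u x‖) :
    MonotoneOn (fun y ↦ ‖u y‖) (Iic b) := by
  have hpos := re_conj_mul_deriv_nonneg_of_isBoundedUnder h hq hbdd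
  have h1 : ∀ x ∈ Iic b, HasDerivAt (fun y ↦ ‖u y‖ ^ 2) (2 * (conj (u x) * u' x).re) x :=
    fun x hx ↦ hasDerivAt_norm_sq_complex (h x hx).1
  have hmono : MonotoneOn (fun y ↦ ‖u y‖ ^ 2) (Iic b) := by
    refine monotoneOn_of_deriv_nonneg (convex_Iic b)
      (fun x hx ↦ (h1 x hx).continuousAt.continuousWithinAt)
      (fun x hx ↦ (h1 x (interior_subset hx)).differentiableAt.differentiableWithinAt) ?_
    intro x hx
    rw [(h1 x (interior_subset hx)).deriv]
    have := hpos x (interior_subset hx)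
    positivity
  intro x hx y hy hxy
  have := hmono hx hy hxy
  simp only at this
  exact (pow_le_pow_iff_left₀ (norm_nonneg _) (norm_nonneg _) two_ne_zero).1 this

/-- **Two-point form**: under the same hypotheses, `|u(x)| ≤ |u(y)|` whenever `x ≤ y ≤ b`.
[cite: Hartman2002, Ch. XI Cor. 6.4 (proof)] -/
theorem norm_le_norm_of_isBoundedUnder {u u' : ℝ → ℂ} {q : ℝ → ℝ} {b : ℝ}
    (h : ∀ x ∈ Iic b, HasDerivAt u (u' x) x ∧ HasDerivAt u' ((q x : ℂ) * u x) x)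
    (hq : ∀ x ∈ Iic b, 0 ≤ q x) (hbdd : IsBoundedUnder (· ≤ ·) atBot fun x ↦ ‖u x‖)
    {x y : ℝ} (hxy : x ≤ y) (hy : y ≤ b) : ‖u x‖ ≤ ‖u y‖ :=
  monotoneOn_norm_of_isBoundedUnder h hq hbdd (mem_Iic.2 (hxy.trans hy)) (mem_Iic.2 hy) hxy

/-- **The limit at `−∞` is a lower bound**: if moreover `|u(x)| → l` as `x → −∞`, then `l ≤ |u(y)|`
for every `y ≤ b` (monotonicity and `ge_of_tendsto`). [folklore] -/
theorem le_norm_of_tendsto_atBot {u u' : ℝ → ℂ} {q : ℝ → ℝ} {b l : ℝ}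
    (h : ∀ x ∈ Iic b, HasDerivAt u (u' x) x ∧ HasDerivAt u' ((q x : ℂ) * u x) x)
    (hq : ∀ x ∈ Iic b, 0 ≤ q x) (hlim : Tendsto (fun x ↦ ‖u x‖) atBot (𝓝 l)) {y : ℝ}
    (hy : y ≤ b) : l ≤ ‖u y‖ := by
  have hbdd : IsBoundedUnder (· ≤ ·) atBot fun x ↦ ‖u x‖ := hlim.isBoundedUnder_le
  refine le_of_tendsto hlim ?_
  filter_upwards [eventually_le_atBot y] with x hx
  exact norm_le_norm_of_isBoundedUnder h hq hbdd hx hy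

end Literature.Analysis.ODE

end
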